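import Mathlib
import HarnessLib
import Summits.NavierStokesRegularity.NavierStokesRegularity.Theorems.PoloidalWindowDoorLrcModEntireRidgeHullValues
import Summits.NavierStokesRegularity.NavierStokesRegularity.Theorems.PoloidalWindowDoorLrcModEntireRidgeUniformLateral
import Summits.NavierStokesRegularity.NavierStokesRegularity.Theorems.PoloidalWindowDoorLrcModEntireRidgeConcavityTube
import Summits.NavierStokesRegularity.NavierStokesRegularity.Theorems.PoloidalWindowDoorLrcModEntireRidgeWebFermat
import Summits.NavierStokesRegularity.NavierStokesRegularity.Theorems.PoloidalWindowDoorLrcModEntireRidgeClassConstants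

/-!
# Item `LrcModEntire` (stmt-NavierStokesRegularity-20428) — THE (Q4) ENTRANCE AT CLASS LEVEL, ONE THEOREM: a class profile with a complete uniformly non-degenerate hot
# branch has a hull element carrying a HOMOGENEOUS RIDGE WEB with the first-order web (Fermat) law — no tube, level, window or modulus left as an input

ns-k2-port-2 g6 (helper prover under the LEAD of item 20428, ns-poloidal-K2-p3 g15; `--supports stmt-NavierStokesRegularity-20428 --as helper`).
Memo `Cruxes/LrcModEntire/T2B-g14.md` §13b (Q3∞) / §14 (Q4).  Port-2 g5 landed the pipeline (Q3∞) `…RidgeHullValues.exists_hullLimit_crossSectionMax_const` → (U-LL)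
`…RidgeUniformLateral` + `…RidgeConcavityTube.hessian_neg_on_tube` + `…RidgeWebFermat.web_fermat`, modulo «three class constants AT the hull limit `U`» and the uniform
lateral level along the branch.  This file discharges all of them from the class (`…RidgeClassConstants.exists_signedClassConstants`: the KNSS window bounds and time-Lipschitz
moduli are UNIFORM over the class with Type-I constant `C`, and a hull limit has the same `C`), choosing ONE tube radius `r` and ONE window `δ` from `(C, κ₀)`-data that serve
both the profile `v` and its hull limit `U`:

* `exists_hullLimit_ridgeWeb` — hypotheses: the pinned peakless class package of `v` VERBATIM (as in `…HotHullCompactness.hullLimit`), a sign `σ = ±1`, a COMPLETE `C²`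
  unit-speed hot branch `γ ⊂ P₀` with in-plane normal `ν` and uniform transversal non-degeneracy `−D²(σv₂(−1,·))(γ s)[ν s, ν s] ≥ κ₀ > 0` (BRANCH-PARAM, the one
  geometric input), base parameters `s_k → +∞`.  Conclusion: a hull limit `U` (pinned, peakless, same hot value, slices converging locally uniformly) with its limit branch
  `Γ` (re-entry package: critical hot set, `Γ ∈ C^∞`, unit speed in `P₀`, hot, `κ₀`-non-degenerate), a radius `r > 0`, a window `0 < δ ≤ 1/4` and a level `m` such that,
  writing `F τ = σU₂(−1+τ,·)`, `Ψ(s,n,z) = Γ s + nν_Γ s + z e₂`, `R(τ,z) = max_{|n|≤r} F τ (Ψ(0,n,z))`: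
  (Q3∞) `max_{|n|≤r} F τ (Ψ(s,n,z)) = R(τ,z)` for all `s` and `|τ|,|z| < δ`; cold lateral / hot centre `F τ (Ψ(s,±r,z)) < m ≤ F τ (Ψ(s,0,z))`; strict concavity
  `D²(F τ)(Ψ(s,n,z))[ν_Γ s, ν_Γ s] < 0` for `|n| < r`; and the WEB FERMAT LAW: for all `|τ₀|,|z₀| < δ`, `s₀`: a unique interior web point `n₀ ∈ (−r,r)` with
  `F τ₀ (Ψ(s₀,n₀,z₀)) = R(τ₀,z₀)`, `uncurry R` differentiable at `(τ₀,z₀)`, and `D(uncurry F)(τ₀, Ψ(s₀,n₀,z₀)) = D(uncurry R)(τ₀,z₀) ∘ ((τ,y) ↦ (τ,y₂))`.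

So the survivor portrait of the (TH) column (memo §14e) — «a proper, unbounded, transversally non-degenerate hot ridge, value-homogeneous after one hull extraction, with the
web laws» — is ONE by-name implication from the class package plus BRANCH-PARAM; the research cell (Q4) starts from its conclusion.

WHAT THIS IS NOT: not a claim about Navier–Stokes regularity — the entrance of the research cell (Q4) «HOMOGENEOUS NULL RIDGE» for hypothetical blow-up profiles
(bears_on LADDER-NS N0, item 20428 / crux 19708; 20428/19708/27893 OPEN; (Q4) OPEN; `stub_T2b` NOT closed).  No summit statement is proved here.
-/

noncomputable section

-- the summit and its single sub-problem share the name (CONVENTIONS §1), as in every Theorems file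
set_option linter.dupNamespace false

namespace Summit.NavierStokesRegularity.NavierStokesRegularity.Theorems.PoloidalWindowDoorLrcModEntireRidgeWebClass

open Set Filter Topology Metric Function
open scoped ContDiff InnerProductSpace RealInnerProductSpace Laplacian
open Literature.Analysis Literature.Analysis.FluidPDE
open Summit.NavierStokesRegularity.NavierStokesRegularity.Theorems.PoloidalWindowDoorLrcModEntireRidgeTaylor
open Summit.NavierStokesRegularity.NavierStokesRegularity.Theorems.PoloidalWindowDoorLrcModEntireRidgeClass
open Summit.NavierStokesRegularity.NavierStokesRegularity.Theorems.PoloidalWindowDoorLrcModEntireRidgeBranchCurvature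
open Summit.NavierStokesRegularity.NavierStokesRegularity.Theorems.PoloidalWindowDoorLrcModEntireRidgeHullIterate
open Summit.NavierStokesRegularity.NavierStokesRegularity.Theorems.PoloidalWindowDoorLrcModEntireRidgeHullValues
open Summit.NavierStokesRegularity.NavierStokesRegularity.Theorems.PoloidalWindowDoorLrcModEntireRidgeUniformLateral
open Summit.NavierStokesRegularity.NavierStokesRegularity.Theorems.PoloidalWindowDoorLrcModEntireRidgeConcavityTube
open Summit.NavierStokesRegularity.NavierStokesRegularity.Theorems.PoloidalWindowDoorLrcModEntireRidgeWebFermat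
open Summit.NavierStokesRegularity.NavierStokesRegularity.Theorems.PoloidalWindowDoorLrcModEntireRidgeClassConstants

/-! ### Arithmetic of the tube radius and the window -/

/-- The tube radius `r = κ₀ / (64 (K₃ + 1))`: positive, `32 K₃ r ≤ κ₀`, `r · (K₃/κ₀) < 1`, `K₃ r ≤ κ₀/64`. -/
theorem radius_facts {κ₀ K₃ : ℝ} (hκ₀ : 0 < κ₀) (hK₃ : 0 ≤ K₃) :
    0 < κ₀ / (64 * (K₃ + 1)) ∧ 32 * K₃ * (κ₀ / (64 * (K₃ + 1))) ≤ κ₀ ∧ κ₀ / (64 * (K₃ + 1)) * (K₃ / κ₀) < 1 ∧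
      K₃ * (κ₀ / (64 * (K₃ + 1))) ≤ κ₀ / 64 := by
  have h1 : 0 < K₃ + 1 := by linarith
  have hq : K₃ / (K₃ + 1) ≤ 1 := by rw [div_le_one h1]; linarith
  have hq0 : 0 ≤ K₃ / (K₃ + 1) := by positivity
  refine ⟨by positivity, ?_, ?_, ?_⟩
  · have e : 32 * K₃ * (κ₀ / (64 * (K₃ + 1))) = κ₀ / 2 * (K₃ / (K₃ + 1)) := by field_simp; ring
    rw [e]; nlinarith
  · have e : κ₀ / (64 * (K₃ + 1)) * (K₃ / κ₀) = K₃ / (K₃ + 1) / 64 := by field_simp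
    rw [e]; linarith
  · have e : K₃ * (κ₀ / (64 * (K₃ + 1))) = κ₀ / 64 * (K₃ / (K₃ + 1)) := by field_simp
    rw [e]; nlinarith

/-- The window `δ = min (min (1/4) r) (min (κ₀r²/(8D)) (κ₀/(64(K₃+L₂+1))))`, `D = 2K₂r + L₀ + κ₀r + 1`: positive, `≤ 1/4`, `≤ r`, `8Dδ ≤ κ₀r²`, and with `K₃ r ≤ κ₀/64`
the thin-tube inequality `K₃(r + δ) + L₂δ < κ₀`. -/
theorem window_facts {κ₀ K₂ K₃ L₀ L₂ r : ℝ} (hκ₀ : 0 < κ₀) (hK₂ : 0 ≤ K₂) (hK₃ : 0 ≤ K₃) (hL₀ : 0 ≤ L₀) (hL₂ : 0 ≤ L₂) (hr : 0 < r)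
    (hK₃r : K₃ * r ≤ κ₀ / 64) :
    let D := 2 * K₂ * r + L₀ + κ₀ * r + 1
    let δ := min (min (1 / 4) r) (min (κ₀ * r ^ 2 / (8 * D)) (κ₀ / (64 * (K₃ + L₂ + 1))))
    0 < δ ∧ δ ≤ 1 / 4 ∧ δ ≤ r ∧ 8 * (2 * K₂ * r + L₀ + κ₀ * r + 1) * δ ≤ κ₀ * r ^ 2 ∧ K₃ * (r + δ) + L₂ * δ < κ₀ := by
  intro D δ
  have hD : 0 < D := by show 0 < 2 * K₂ * r + L₀ + κ₀ * r + 1; nlinarith [mul_pos hκ₀ hr, mul_nonneg hK₂ hr.le]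
  have hE : 0 < K₃ + L₂ + 1 := by linarith
  have hδpos : 0 < δ := lt_min (lt_min (by norm_num) hr) (lt_min (by positivity) (by positivity))
  have hδ1 : δ ≤ 1 / 4 := (min_le_left _ _).trans (min_le_left _ _)
  have hδr : δ ≤ r := (min_le_left _ _).trans (min_le_right _ _)
  have hδD : δ ≤ κ₀ * r ^ 2 / (8 * D) := (min_le_right _ _).trans (min_le_left _ _)
  have hδE : δ ≤ κ₀ / (64 * (K₃ + L₂ + 1)) := (min_le_right _ _).trans (min_le_right _ _)
  refine ⟨hδpos, hδ1, hδr, ?_, ?_⟩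
  · have h := mul_le_mul_of_nonneg_left hδD (by positivity : (0 : ℝ) ≤ 8 * D)
    have e : 8 * D * (κ₀ * r ^ 2 / (8 * D)) = κ₀ * r ^ 2 := by field_simp
    show 8 * D * δ ≤ κ₀ * r ^ 2
    linarith
  · have h1 : (K₃ + L₂) * δ ≤ κ₀ / 64 := by
      have h := mul_le_mul_of_nonneg_left hδE (by positivity : (0 : ℝ) ≤ K₃ + L₂)
      have hq : (K₃ + L₂) * (κ₀ / (64 * (K₃ + L₂ + 1))) = κ₀ / 64 * ((K₃ + L₂) / (K₃ + L₂ + 1)) := by field_simp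
      have hle : (K₃ + L₂) / (K₃ + L₂ + 1) ≤ 1 := by rw [div_le_one hE]; linarith
      have h0 : 0 ≤ (K₃ + L₂) / (K₃ + L₂ + 1) := by positivity
      rw [hq] at h
      nlinarith
    nlinarith

/-! ### The class-level entrance -/

/-- **THE (Q4) ENTRANCE AT CLASS LEVEL.**  See the module docstring.  The branch `γ` (complete, unit speed, hot, uniformly non-degenerate) is the only non-class input. -/
theorem exists_hullLimit_ridgeWeb (C : ℝ) (v : ℝ → EuclideanSpace ℝ (Fin 3) → EuclideanSpace ℝ (Fin 3))
    (hP : (Literature.Analysis.FluidPDE.HasTypeITimeDecay C v ∧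
        ContinuousOn (Function.uncurry v) (Set.Iio (0 : ℝ) ×ˢ Set.univ) ∧
        (∀ s t : ℝ, s < t → t < 0 → ∀ x, v t x =
          Literature.Analysis.UnboundedOperators.heatExtension (v s) (t - s) x -
            Literature.Analysis.FluidPDE.oseenDuhamel 1 s v v t x) ∧
        (∀ t < 0, Literature.Analysis.FluidPDE.VectorCalculus.IsDivFree (v t)) ∧
        (∀ s < 0, ∀ q, ⟪Literature.Analysis.FluidPDE.curl (v s) q, EuclideanSpace.single 2 1⟫_ℝ = 0) ∧
        v (-1) 0 2 ≠ 0 ∧ (∀ t < 0, ∀ x, Real.sqrt (-t) * |v t x 2| ≤ |v (-1) 0 2|) ∧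
        (∀ h : EuclideanSpace ℝ (Fin 3), fderiv ℝ (v (-1)) 0 h 2 = 0) ∧
        (deriv (fun s => v s 0 2) (-1) = v (-1) 0 2 / 2 ∧ v (-1) 0 2 * (Δ (fun q => v (-1) q 2)) 0 ≤ 0)))
    (hK : (∀ (s z₀ σ M : ℝ) (K O : Set (EuclideanSpace ℝ (Fin 3))), s < 0 →
        ((σ = 1 ∨ σ = -1) ∧ IsCompact K ∧ K.Nonempty ∧ (∀ q ∈ K, q 2 = z₀ ∧ σ * v s q 2 = M) ∧
          IsOpen O ∧ K ⊆ O ∧ (∀ q ∈ O, q 2 = z₀ → σ * v s q 2 ≤ M) ∧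
          (∀ q ∈ O, q 2 = z₀ → σ * v s q 2 = M → q ∈ K)) → False))
    {σ : ℝ} (hσ : σ = 1 ∨ σ = -1)
    {γ : ℝ → EuclideanSpace ℝ (Fin 3)} (hγ2 : ContDiff ℝ 2 γ) (hplane : ∀ s, γ s 2 = 0) (hunit : ∀ s, ‖deriv γ s‖ = 1)
    (hhot : ∀ s, v (-1) (γ s) 2 = v (-1) 0 2)
    {ν : ℝ → EuclideanSpace ℝ (Fin 3)} (hν : ∀ s, ν s = WithLp.toLp 2 ![-(deriv γ s 1), deriv γ s 0, 0])
    {κ₀ : ℝ} (hκ₀ : 0 < κ₀) (hκ : ∀ s, κ₀ ≤ -(fderiv ℝ (fderiv ℝ (fun y => σ * v (-1) y 2)) (γ s) (ν s) (ν s)))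
    {sq : ℕ → ℝ} (hsq : Tendsto sq atTop atTop) :
    ∃ (φ : ℕ → ℕ) (U : ℝ → EuclideanSpace ℝ (Fin 3) → EuclideanSpace ℝ (Fin 3)) (Γ νΓ : ℝ → EuclideanSpace ℝ (Fin 3))
      (F : ℝ → EuclideanSpace ℝ (Fin 3) → ℝ) (R : ℝ → ℝ → ℝ) (r δ m : ℝ), StrictMono φ ∧
      -- the hull limit (pinned, peakless, same hot value), slices converging locally uniformly, re-based branches converging to `Γ`
      (Literature.Analysis.FluidPDE.HasTypeITimeDecay C U ∧
        ContinuousOn (Function.uncurry U) (Set.Iio (0 : ℝ) ×ˢ Set.univ) ∧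
        (∀ s t : ℝ, s < t → t < 0 → ∀ x, U t x =
          Literature.Analysis.UnboundedOperators.heatExtension (U s) (t - s) x -
            Literature.Analysis.FluidPDE.oseenDuhamel 1 s U U t x) ∧
        (∀ t < 0, Literature.Analysis.FluidPDE.VectorCalculus.IsDivFree (U t)) ∧
        (∀ s < 0, ∀ q, ⟪Literature.Analysis.FluidPDE.curl (U s) q, EuclideanSpace.single 2 1⟫_ℝ = 0) ∧
        U (-1) 0 2 ≠ 0 ∧ (∀ t < 0, ∀ x, Real.sqrt (-t) * |U t x 2| ≤ |U (-1) 0 2|) ∧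
        (∀ h : EuclideanSpace ℝ (Fin 3), fderiv ℝ (U (-1)) 0 h 2 = 0) ∧
        (deriv (fun s => U s 0 2) (-1) = U (-1) 0 2 / 2 ∧ U (-1) 0 2 * (Δ (fun q => U (-1) q 2)) 0 ≤ 0)) ∧
      (∀ (s z₀ σ M : ℝ) (K O : Set (EuclideanSpace ℝ (Fin 3))), s < 0 →
        ((σ = 1 ∨ σ = -1) ∧ IsCompact K ∧ K.Nonempty ∧ (∀ q ∈ K, q 2 = z₀ ∧ σ * U s q 2 = M) ∧
          IsOpen O ∧ K ⊆ O ∧ (∀ q ∈ O, q 2 = z₀ → σ * U s q 2 ≤ M) ∧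
          (∀ q ∈ O, q 2 = z₀ → σ * U s q 2 = M → q ∈ K)) → False) ∧
      U (-1) 0 2 = v (-1) 0 2 ∧
      (∀ t < 0, TendstoLocallyUniformly (fun j x => v t (x + γ (sq (φ j)))) (U t) atTop) ∧
      (∀ s, Tendsto (fun j => γ (sq (φ j) + s) - γ (sq (φ j))) atTop (𝓝 (Γ s))) ∧
      -- re-entry package of the limit branch
      (∀ y ∈ {y : EuclideanSpace ℝ (Fin 3) | y 2 = 0 ∧ U (-1) y 2 = U (-1) 0 2}, fderiv ℝ (fun x => U (-1) x 2) y = 0) ∧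
      ContDiff ℝ ∞ Γ ∧ Γ 0 = 0 ∧ (∀ s, Γ s 2 = 0) ∧ (∀ s, ‖deriv Γ s‖ = 1) ∧ (∀ s, U (-1) (Γ s) 2 = U (-1) 0 2) ∧
      (∀ s, νΓ s = WithLp.toLp 2 ![-(deriv Γ s 1), deriv Γ s 0, 0]) ∧
      (∀ s, κ₀ ≤ -(fderiv ℝ (fderiv ℝ (fun y => σ * U (-1) y 2)) (Γ s) (νΓ s) (νΓ s))) ∧
      -- the signed space–time component, the homogeneous ridge height, the tube radius, the window, the level
      (F = fun τ y => σ * U (-1 + τ) y 2) ∧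
      (∀ τ z, R τ z = sSup ((fun n : ℝ => F τ (Γ 0 + n • νΓ 0 + z • EuclideanSpace.single 2 (1 : ℝ))) '' Icc (-r) r)) ∧
      0 < r ∧ 0 < δ ∧ δ ≤ 1 / 4 ∧
      -- (Q3∞): the cross-section maximum is homogeneous along `Γ`
      (∀ τ z : ℝ, |τ| < δ → |z| < δ → ∀ s : ℝ,
        sSup ((fun n : ℝ => F τ (Γ s + n • νΓ s + z • EuclideanSpace.single 2 (1 : ℝ))) '' Icc (-r) r) = R τ z) ∧
      -- cold lateral values, hot centre
      (∀ τ z : ℝ, |τ| < δ → |z| < δ → ∀ s n : ℝ, (n = r ∨ n = -r) → F τ (Γ s + n • νΓ s + z • EuclideanSpace.single 2 (1 : ℝ)) < m) ∧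
      (∀ τ z : ℝ, |τ| < δ → |z| < δ → ∀ s : ℝ, m ≤ F τ (Γ s + z • EuclideanSpace.single 2 (1 : ℝ))) ∧
      -- strict concavity of the cross-sections on the open tube
      (∀ τ z : ℝ, |τ| < δ → |z| < δ → ∀ s : ℝ, ∀ n ∈ Ioo (-r) r,
        fderiv ℝ (fderiv ℝ (F τ)) (Γ s + n • νΓ s + z • EuclideanSpace.single 2 (1 : ℝ)) (νΓ s) (νΓ s) < 0) ∧
      -- THE WEB FERMAT LAW at every cross-section
      (∀ τ₀ z₀ : ℝ, |τ₀| < δ → |z₀| < δ → ∀ s₀ : ℝ, ∃ n₀ ∈ Ioo (-r) r,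
        F τ₀ (Γ s₀ + n₀ • νΓ s₀ + z₀ • EuclideanSpace.single 2 (1 : ℝ)) = R τ₀ z₀ ∧
        (∀ n ∈ Icc (-r) r, n ≠ n₀ → F τ₀ (Γ s₀ + n • νΓ s₀ + z₀ • EuclideanSpace.single 2 (1 : ℝ)) < R τ₀ z₀) ∧
        DifferentiableAt ℝ (uncurry R) (τ₀, z₀) ∧
        fderiv ℝ (uncurry F) (τ₀, Γ s₀ + n₀ • νΓ s₀ + z₀ • EuclideanSpace.single 2 (1 : ℝ)) =
          (fderiv ℝ (uncurry R) (τ₀, z₀)).comp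
            ((ContinuousLinearMap.fst ℝ ℝ (EuclideanSpace ℝ (Fin 3))).prod
              ((EuclideanSpace.proj (2 : Fin 3)).comp (ContinuousLinearMap.snd ℝ ℝ (EuclideanSpace ℝ (Fin 3)))))) := by
  have hP' := hP
  obtain ⟨hrate, hcont, hmild, hdivf, hpol, hN, hpin, hgrad0, hpins⟩ := hP'
  have hneg : (-1 : ℝ) < 0 := by norm_num
  set e₂ : EuclideanSpace ℝ (Fin 3) := EuclideanSpace.single 2 (1 : ℝ) with he₂
  have he₂1 : ‖e₂‖ = 1 := by simp [he₂]
  set M : ℝ := σ * v (-1) 0 2 with hM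
  -- ## the class constants, uniform over the class with constant `C`
  obtain ⟨K₂, K₃, L₀, L₂, hK₂0, hK₃0, hL₀0, hL₂0, hcl⟩ := exists_signedClassConstants C
  obtain ⟨h3v, h2s, h3s, h0s, -⟩ := hcl hrate hcont hmild hdivf hσ
  have hq : |(0 : ℝ)| ≤ 1 / 4 := by norm_num
  -- ## the radius and the window
  obtain ⟨hr, hthin32, hrB, hK₃r⟩ := radius_facts hκ₀ hK₃0
  set r : ℝ := κ₀ / (64 * (K₃ + 1)) with hrdef
  obtain ⟨hδ, hδ14, hδr, hδs, hthin⟩ := window_facts hκ₀ hK₂0 hK₃0 hL₀0 hL₂0 hr hK₃r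
  set δ : ℝ := min (min (1 / 4) r) (min (κ₀ * r ^ 2 / (8 * (2 * K₂ * r + L₀ + κ₀ * r + 1))) (κ₀ / (64 * (K₃ + L₂ + 1)))) with hδdef
  have hδhalf : δ ≤ 1 / 2 := hδ14.trans (by norm_num)
  -- ## the signed slice of `v` at `t = −1`: smooth, bounded jets, critical along the hot branch
  set f : EuclideanSpace ℝ (Fin 3) → ℝ := fun y => σ * v (-1) y 2 with hfdef
  have hf3 : ContDiff ℝ 3 f := contDiff_signed_slice hrate hcont hmild hdivf hneg σ
  have hfC₃ : ∀ x, ‖iteratedFDeriv ℝ 3 f x‖ ≤ K₃ := fun x => by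
    have h := h3s 0 hq x; simp only [add_zero] at h; exact h
  have hfC₂ : ∀ x, ‖iteratedFDeriv ℝ 2 f x‖ ≤ K₂ := fun x => by
    have h := h2s 0 hq x; simp only [add_zero] at h; exact h
  have hvC₃ : ∀ x, ‖iteratedFDeriv ℝ 3 (v (-1)) x‖ ≤ K₃ := fun x => by
    have h := h3v 0 hq x; simp only [add_zero] at h; exact h
  have hcritv := fderiv_two_eq_zero_of_hot (U := v) hpin
  have hv2d : Differentiable ℝ (fun y => v (-1) y 2) :=
    ((contDiff_piLp_apply (p := 2) (𝕜 := ℝ) (E := fun _ : Fin 3 => ℝ) (i := (2 : Fin 3))).comp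
      (contDiff_slice_of_class hrate hcont hmild hdivf hneg (n := 1))).differentiable one_ne_zero
  have hfcrit : ∀ s, fderiv ℝ f (γ s) = 0 := fun s => by
    rw [hfdef, fderiv_const_mul (hv2d _), hcritv (γ s) ⟨hplane s, hhot s⟩, smul_zero]
  have hγd : Differentiable ℝ γ := hγ2.differentiable (by norm_num)
  have hν1 : ∀ s, ‖ν s‖ = 1 := norm_planeNormal_eq_one hγd hplane hunit hν
  -- ## (U-LL) for `v`: the second-order expansion at every hot point, the temporal modulus, the constant level
  set W : ℝ → ℝ → ℝ → ℝ → ℝ := fun τ s n z => σ * v (-1 + τ) (γ s + n • ν s + z • e₂) 2 with hW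
  set κf : ℝ → ℝ := fun s => -(fderiv ℝ (fderiv ℝ f) (γ s) (ν s) (ν s)) with hκf
  set αf : ℝ → ℝ := fun s => fderiv ℝ (fderiv ℝ f) (γ s) (ν s) e₂ with hαf
  set βf : ℝ → ℝ := fun s => fderiv ℝ (fderiv ℝ f) (γ s) e₂ e₂ with hβf
  have hexp : ∀ s n z : ℝ, |W 0 s n z - (M - κf s / 2 * n ^ 2 + αf s * n * z + βf s / 2 * z ^ 2)| ≤ K₃ * (|n| + |z|) ^ 3 := by
    intro s n z
    have h := ridgeExpansion_of_contDiff hf3 hfC₃ (hfcrit s) (hν1 s).le he₂1.le (κ := κf s) (α := αf s) (β := βf s) rfl rfl rfl n z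
    have e1 : W 0 s n z = f (γ s + n • ν s + z • e₂) := by simp only [hW, hfdef, add_zero]
    have e2 : f (γ s) = M := by simp only [hfdef, hM]; rw [hhot s]
    rw [e1, ← e2]; exact h
  have hκf' : ∀ s, κ₀ ≤ κf s := fun s => hκ s
  have hαA : ∀ s, |αf s| ≤ K₂ := fun s => by
    refine (abs_fderiv_fderiv_le (γ s) (ν s) e₂).trans ?_
    rw [hν1 s, he₂1, mul_one, mul_one]; exact hfC₂ _
  have hβA : ∀ s, |βf s| ≤ K₂ := fun s => by
    refine (abs_fderiv_fderiv_le (γ s) e₂ e₂).trans ?_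
    rw [he₂1, mul_one, mul_one]; exact hfC₂ _
  have htime : ∀ τ s n z : ℝ, |τ| ≤ 1 / 4 → |W τ s n z - W 0 s n z| ≤ L₀ * |τ| := by
    intro τ s n z hτ
    have h := h0s τ hτ (γ s + n • ν s + z • e₂)
    simp only [hW, add_zero]; exact h
  have hq4 : (0 : ℝ) < 1 / 4 := by norm_num
  have hlatv : ∀ τ z : ℝ, |τ| < δ → |z| < δ → ∀ s n : ℝ, (n = r ∨ n = -r) →
      σ * v (-1 + τ) (γ s + n • ν s + z • e₂) 2 < (fun _ _ : ℝ => M - κ₀ * r ^ 2 / 8) τ z := fun τ z hτ hz s n hn =>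
    lateral_lt_level hexp hκf' hαA hβA hκ₀ hK₂0 hK₃0 htime hL₀0 hr hthin32 hδ14 hδr hδs hτ hz s n hn
  have hmidv : ∀ τ z : ℝ, |τ| < δ → |z| < δ → ∀ s : ℝ,
      (fun _ _ : ℝ => M - κ₀ * r ^ 2 / 8) τ z ≤ σ * v (-1 + τ) (γ s + z • e₂) 2 := fun τ z hτ hz s => by
    have h := level_le_centre hexp hβA hκ₀ hK₂0 htime hL₀0 hr hthin32 hδ14 hδr hδs hτ hz s
    simpa only [hW, zero_smul, add_zero] using h
  -- ## (Q3∞): the hull limit with the homogeneous cross-section maximum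
  obtain ⟨φ, U, Γ, hφ, hPU, hKU, hUN, hconv, hptγ, hcritU, hΓs, hΓ0, hΓplane, hΓunit, hΓhot, hκU, hhom⟩ :=
    exists_hullLimit_crossSectionMax_const C v hP hK hσ hγ2 hplane hunit hhot hν hκ₀ hκ hvC₃ hr hrB hδhalf hlatv hmidv hsq
  obtain ⟨hrateU, hcontU, hmildU, hdivU, hpolU, hNU, hpinU, hgrad0U, hpinsU⟩ := hPU
  -- ## the limit branch: normal frame, smoothness, curvature
  set νΓ : ℝ → EuclideanSpace ℝ (Fin 3) := fun s => WithLp.toLp 2 ![-(deriv Γ s 1), deriv Γ s 0, 0] with hνΓdef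
  have hνΓ : ∀ s, νΓ s = WithLp.toLp 2 ![-(deriv Γ s 1), deriv Γ s 0, 0] := fun s => rfl
  have hΓ2 : ContDiff ℝ 2 Γ := hΓs.of_le (by exact WithTop.coe_le_coe.2 le_top)
  have hΓd : Differentiable ℝ Γ := hΓ2.differentiable (by norm_num)
  have hνΓ1 : ∀ s, ‖νΓ s‖ = 1 := norm_planeNormal_eq_one hΓd hΓplane hΓunit hνΓ
  -- ## the class constants AT THE HULL LIMIT: the same `K₂, K₃, L₀, L₂` (same Type-I constant `C`)
  obtain ⟨-, h2U, h3U, h0U, h22U⟩ := hcl hrateU hcontU hmildU hdivU hσ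
  set fU : EuclideanSpace ℝ (Fin 3) → ℝ := fun y => σ * U (-1) y 2 with hfUdef
  have hfU3 : ContDiff ℝ 3 fU := contDiff_signed_slice hrateU hcontU hmildU hdivU hneg σ
  have hfUC₃ : ∀ x, ‖iteratedFDeriv ℝ 3 fU x‖ ≤ K₃ := fun x => by
    have h := h3U 0 hq x; simp only [add_zero] at h; exact h
  have hfUC₂ : ∀ x, ‖iteratedFDeriv ℝ 2 fU x‖ ≤ K₂ := fun x => by
    have h := h2U 0 hq x; simp only [add_zero] at h; exact h
  have hU2d : Differentiable ℝ (fun y => U (-1) y 2) :=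
    ((contDiff_piLp_apply (p := 2) (𝕜 := ℝ) (E := fun _ : Fin 3 => ℝ) (i := (2 : Fin 3))).comp
      (contDiff_slice_of_class hrateU hcontU hmildU hdivU hneg (n := 1))).differentiable one_ne_zero
  have hfUcrit : ∀ s, fderiv ℝ fU (Γ s) = 0 := fun s => by
    rw [hfUdef, fderiv_const_mul (hU2d _), hcritU (Γ s) ⟨hΓplane s, hΓhot s⟩, smul_zero]
  have hκU' : ∀ s, fderiv ℝ (fderiv ℝ fU) (Γ s) (νΓ s) (νΓ s) ≤ -κ₀ := fun s => by
    have h := hκU s; simp only [hfUdef]; linarith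
  have hB : ∀ s, ‖deriv (deriv Γ) s‖ ≤ K₃ / κ₀ :=
    norm_deriv_deriv_le_of_critical_planeBranch hfU3 le_rfl hΓ2 hΓplane hΓunit hfUcrit hνΓ hκ₀ hκU' (fun s => hfUC₃ (Γ s))
  -- ## the signed space–time component `F τ = σU₂(−1+τ, ·)` and the homogeneous height `R`
  set F : ℝ → EuclideanSpace ℝ (Fin 3) → ℝ := fun τ y => σ * U (-1 + τ) y 2 with hFdef
  have hF0 : F 0 = fU := by funext y; simp only [hFdef, hfUdef, add_zero]
  set R : ℝ → ℝ → ℝ := fun τ z => sSup ((fun n : ℝ => F τ (Γ 0 + n • νΓ 0 + z • e₂)) '' Icc (-r) r) with hRdef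
  have hR : ∀ τ z, R τ z = sSup ((fun n : ℝ => F τ (Γ 0 + n • νΓ 0 + z • e₂)) '' Icc (-r) r) := fun _ _ => rfl
  -- ## (U-LL) for `U` with the SAME radius, window and level
  set WU : ℝ → ℝ → ℝ → ℝ → ℝ := fun τ s n z => F τ (Γ s + n • νΓ s + z • e₂) with hWU
  set κU : ℝ → ℝ := fun s => -(fderiv ℝ (fderiv ℝ fU) (Γ s) (νΓ s) (νΓ s)) with hκUdef
  set αU : ℝ → ℝ := fun s => fderiv ℝ (fderiv ℝ fU) (Γ s) (νΓ s) e₂ with hαUdef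
  set βU : ℝ → ℝ := fun s => fderiv ℝ (fderiv ℝ fU) (Γ s) e₂ e₂ with hβUdef
  have hexpU : ∀ s n z : ℝ, |WU 0 s n z - (M - κU s / 2 * n ^ 2 + αU s * n * z + βU s / 2 * z ^ 2)| ≤ K₃ * (|n| + |z|) ^ 3 := by
    intro s n z
    have h := ridgeExpansion_of_contDiff hfU3 hfUC₃ (hfUcrit s) (hνΓ1 s).le he₂1.le (κ := κU s) (α := αU s) (β := βU s) rfl rfl rfl n z
    have e1 : WU 0 s n z = fU (Γ s + n • νΓ s + z • e₂) := by simp only [hWU, hFdef, hfUdef, add_zero]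
    have e2 : fU (Γ s) = M := by simp only [hfUdef, hM]; rw [hΓhot s, hUN]
    rw [e1, ← e2]; exact h
  have hκUge : ∀ s, κ₀ ≤ κU s := fun s => by have h := hκU' s; simp only [hκUdef]; linarith
  have hαUA : ∀ s, |αU s| ≤ K₂ := fun s => by
    refine (abs_fderiv_fderiv_le (Γ s) (νΓ s) e₂).trans ?_
    rw [hνΓ1 s, he₂1, mul_one, mul_one]; exact hfUC₂ _
  have hβUA : ∀ s, |βU s| ≤ K₂ := fun s => by
    refine (abs_fderiv_fderiv_le (Γ s) e₂ e₂).trans ?_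
    rw [he₂1, mul_one, mul_one]; exact hfUC₂ _
  have htimeU : ∀ τ s n z : ℝ, |τ| ≤ 1 / 4 → |WU τ s n z - WU 0 s n z| ≤ L₀ * |τ| := by
    intro τ s n z hτ
    have h := h0U τ hτ (Γ s + n • νΓ s + z • e₂)
    simp only [hWU, hFdef, add_zero]; exact h
  have hlatU : ∀ τ z : ℝ, |τ| < δ → |z| < δ → ∀ s n : ℝ, (n = r ∨ n = -r) → F τ (Γ s + n • νΓ s + z • e₂) < M - κ₀ * r ^ 2 / 8 :=
    fun τ z hτ hz s n hn => lateral_lt_level hexpU hκUge hαUA hβUA hκ₀ hK₂0 hK₃0 htimeU hL₀0 hr hthin32 hδ14 hδr hδs hτ hz s n hn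
  have hmidU : ∀ τ z : ℝ, |τ| < δ → |z| < δ → ∀ s : ℝ, M - κ₀ * r ^ 2 / 8 ≤ F τ (Γ s + z • e₂) := fun τ z hτ hz s => by
    have h := level_le_centre hexpU hβUA hκ₀ hK₂0 htimeU hL₀0 hr hthin32 hδ14 hδr hδs hτ hz s
    simpa only [hWU, zero_smul, add_zero] using h
  -- ## strict concavity of the cross-sections on the thin tube
  have hFslice : ∀ τ : ℝ, |τ| < δ → ContDiff ℝ 3 (F τ) := fun τ hτ => by
    have ht : -1 + τ < 0 := by linarith [(abs_lt.1 hτ).2, hδ14]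
    exact contDiff_signed_slice hrateU hcontU hmildU hdivU ht σ
  have hFC₃ : ∀ τ : ℝ, |τ| < δ → ∀ x, ‖iteratedFDeriv ℝ 3 (F τ) x‖ ≤ K₃ := fun τ hτ x => h3U τ (hτ.le.trans hδ14) x
  have hFtime : ∀ τ : ℝ, |τ| < δ → ∀ (y : EuclideanSpace ℝ (Fin 3)) (s : ℝ),
      |fderiv ℝ (fderiv ℝ (F τ)) y (νΓ s) (νΓ s) - fderiv ℝ (fderiv ℝ (F 0)) y (νΓ s) (νΓ s)| ≤ L₂ * |τ| := by
    intro τ hτ y s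
    have h := h22U τ (hτ.le.trans hδ14) y (νΓ s) (νΓ s)
    rw [hνΓ1 s, mul_one, mul_one] at h
    rw [hF0]; exact h
  have hκF : ∀ s, fderiv ℝ (fderiv ℝ (F 0)) (Γ s) (νΓ s) (νΓ s) ≤ -κ₀ := fun s => by rw [hF0]; exact hκU' s
  have hconcU : ∀ τ z : ℝ, |τ| < δ → |z| < δ → ∀ s : ℝ, ∀ n ∈ Ioo (-r) r,
      fderiv ℝ (fderiv ℝ (F τ)) (Γ s + n • νΓ s + z • e₂) (νΓ s) (νΓ s) < 0 := fun τ z hτ hz s n hn =>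
    hessian_neg_on_tube hFslice hFC₃ hFtime (fun s => (hνΓ1 s).le) he₂1.le hκF hK₃0 hL₂0 hδ hthin hτ hz s hn
  -- ## (Q3∞) read as «every cross-section maximum equals the one at `s = 0`»
  have hconstU : ∀ τ z : ℝ, |τ| < δ → |z| < δ → ∀ s : ℝ,
      sSup ((fun n : ℝ => F τ (Γ s + n • νΓ s + z • e₂)) '' Icc (-r) r) = sSup ((fun n : ℝ => F τ (Γ 0 + n • νΓ 0 + z • e₂)) '' Icc (-r) r) := by
    intro τ z hτ hz s
    obtain ⟨R₀, hR₀⟩ := hhom τ z hτ hz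
    have hs := hR₀ s
    have h0 := hR₀ 0
    simp only [hFdef, hνΓdef, he₂] at hs h0 ⊢
    rw [hs, h0]
  -- ## the web Fermat law (port-2 g5 `web_fermat` ∘ LEAD g14 `fderiv_uncurry_eq_of_ridgeWeb`)
  have hT : IsOpen (Ioo (-(1 / 4) : ℝ) (1 / 4)) := isOpen_Ioo
  have hFjoint : ContDiffOn ℝ 2 (uncurry F) (Ioo (-(1 / 4) : ℝ) (1 / 4) ×ˢ (univ : Set (EuclideanSpace ℝ (Fin 3)))) :=
    contDiffOn_uncurry_signed hrateU hcontU hmildU hdivU σ (Ioo_subset_Ioo (by norm_num) (by norm_num))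
  have hδT : Ioo (-δ) δ ⊆ Ioo (-(1 / 4) : ℝ) (1 / 4) := Ioo_subset_Ioo (by linarith) hδ14
  have hweb : ∀ τ₀ z₀ : ℝ, |τ₀| < δ → |z₀| < δ → ∀ s₀ : ℝ, ∃ n₀ ∈ Ioo (-r) r,
      F τ₀ (Γ s₀ + n₀ • νΓ s₀ + z₀ • e₂) = R τ₀ z₀ ∧
      (∀ n ∈ Icc (-r) r, n ≠ n₀ → F τ₀ (Γ s₀ + n • νΓ s₀ + z₀ • e₂) < R τ₀ z₀) ∧
      DifferentiableAt ℝ (uncurry R) (τ₀, z₀) ∧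
      fderiv ℝ (uncurry F) (τ₀, Γ s₀ + n₀ • νΓ s₀ + z₀ • e₂) =
        (fderiv ℝ (uncurry R) (τ₀, z₀)).comp
          ((ContinuousLinearMap.fst ℝ ℝ (EuclideanSpace ℝ (Fin 3))).prod
            ((EuclideanSpace.proj (2 : Fin 3)).comp (ContinuousLinearMap.snd ℝ ℝ (EuclideanSpace ℝ (Fin 3))))) :=
    fun τ₀ z₀ hτ₀ hz₀ s₀ =>
      web_fermat (m := fun _ _ => M - κ₀ * r ^ 2 / 8) hT hFjoint hδT hΓ2 hΓplane hΓunit hB hνΓ hr hrB hR hconstU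
        (fun τ z hτ hz s n hn => hlatU τ z hτ hz s n hn) (fun τ z hτ hz s => hmidU τ z hτ hz s) hconcU hτ₀ hz₀ s₀
  -- ## assemble
  refine ⟨φ, U, Γ, νΓ, F, R, r, δ, M - κ₀ * r ^ 2 / 8, hφ, ⟨hrateU, hcontU, hmildU, hdivU, hpolU, hNU, hpinU, hgrad0U, hpinsU⟩, hKU, hUN,
    hconv, hptγ, hcritU, hΓs, hΓ0, hΓplane, hΓunit, hΓhot, hνΓ, hκU, rfl, hR, hr, hδ, hδ14, ?_, hlatU, hmidU, hconcU, hweb⟩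
  intro τ z hτ hz s
  rw [hR]; exact hconstU τ z hτ hz s

end Summit.NavierStokesRegularity.NavierStokesRegularity.Theorems.PoloidalWindowDoorLrcModEntireRidgeWebClass

end
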